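import Mathlib
import Literature.Analysis.FluidPDE.Tao2016AveragedNS.SelfSimilarCascadeBlowup
import HarnessLib

/-!
# Robust blow-up is stable against EVERY bounded non-negative gain field (controlled / ramped viscosity),
  not only against a constant viscosity — the admissible comparison flows for the survival step (E2) of
  `stub_eternalFromBlowup` (K2(1) `TaoLadderRungTwoBreak.BlowupRigidityOne`, stmt-NavierStokesRegularity-20206)

MODEL lattice ODEs only (Tao 2016 §4 Lemma 4.1 (4.5)–(4.11) and the viscous lattice before Thm. 4.2);
nothing here is a statement about the Navier–Stokes equations; NO item is closed (`--supports
stmt-NavierStokesRegularity-20206`). Route-independent module (no `Theses` import); general `m`; DEF-FREE.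

WHY. The open survival step of the extraction stub reads (census of the earlier hands, (E2)): a robust
blow-up (`NoGlobalCascade ε₀ α X₀`: no global `(K₁,K₂)`-pseudo-solution for any defect budget from all
large shells; κ-normal form `noGlobalCascade_iff_kappa`) must be physically (S₁)-surviving. Its
contrapositive is a CONSTRUCTION: from a non-surviving blow-up, build a global pseudo-solution at every
small budget. The tree's only constructor so far is the constant-viscosity companion
(`hasGlobal_of_viscousGlobal`: a global regular solution of `∂ₜX = quadTerm − ν(1+ε₀)^{2n}X` is a global
`(ν√2, 0)`-pseudo-solution). This file widens the admissible comparison class to CONTROLLED flows: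

* `hasGlobal_of_gainField` — a global (4.5)-regular solution of the lattice damped by an ARBITRARY gain
  field `g : Fin m → ℤ → ℝ → ℝ` with `0 ≤ g_{i,n}(t) ≤ ḡ` (time-, shell- and mode-dependent, no
  regularity asked of `g` beyond what the `C¹` solution records),
  `∂ₜX_{i,n} = quadTerm_{i,n}(X) − g_{i,n}(t)(1+ε₀)^{2n}X_{i,n}`, is a global `(ḡ√2, 0)`-pseudo-solution
  from shell `0` (`HasGlobal ε₀ α (ḡ√2) 0 0 X₀`), with `E = ½X²`: the motion defect is
  `g(1+ε₀)^{2n}|X| ≤ ḡ√2·(1+ε₀)^{2n}√E`, the energy inequality (4.9) is the sign `g ≥ 0`;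
* `not_gainField_of_noGlobalCascade` — contrapositive: a robust blow-up fixes a level `ḡ₀ > 0` such
  that NO gain field with `0 ≤ g ≤ ḡ₀` — no absorber, ramp or switching strategy within that budget —
  steers the one-shell datum to a global (4.5)-regular flow;
* `not_gainField_of_noGlobalCascade_switched` — in particular no flow that is EXACT up to a time `t₁`
  and damped by a budget-`ḡ₀` gain field afterwards is global and (4.5)-regular (the shape of an
  "absorb the front after it has thinned out" construction).

So the (E2) construction may use any measurable feedback law `0 ≤ g ≤ ḡ` realised along a `C¹` flow;
what it may NOT do within `HasGlobal … (ḡ√2) 0` is anti-damp (`g < 0`) or exceed `ḡ` (larger gains need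
the energy-reservoir clause `K₂ > 0` of (4.10), not used here).

HONEST LABEL: an enabling bookkeeping lemma for the next variant of (E2); no stub, crux or summit is
proved; rung 0.
-/

noncomputable section

-- the summit and its single sub-problem share the name (CONVENTIONS §1)
set_option linter.dupNamespace false

open Set Filter Topology MeasureTheory

namespace Summit.NavierStokesRegularity.NavierStokesRegularity.Theorems

namespace BlowupRigidityOne

open Literature.Analysis.FluidPDE Literature.Analysis.FluidPDE.TaoCascade

variable {m : ℕ}

/-- **A global regular flow damped by a bounded non-negative gain field is a pseudo-solution.**
Let `ε₀ > 0` and let `X` be `C¹` on `[0,∞)`, (4.5)-regular on every `[0,T]`, issued from the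
one-shell datum `X₀` at shell `0`, vanishing below shell `0`, and solving
`∂ₜX_{i,n} = quadTerm_{i,n}(X) − g_{i,n}(t)(1+ε₀)^{2n}X_{i,n}` on `[0,∞)` (one-sided derivative within
`[0,∞)`) for some gain field with `0 ≤ g_{i,n}(t) ≤ ḡ` (`t ≥ 0`). Then `(X, ½X²)` is a global
`(ḡ√2, 0)`-pseudo-solution: `HasGlobal ε₀ α (ḡ√2) 0 0 X₀`.
[cite: Tao2016AveragedNS, §4 Lemma 4.1 (4.5)–(4.11) and the remark after (4.11) (the viscous lattice); cell vocabulary (`HasGlobal`)] -/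
theorem hasGlobal_of_gainField {ε₀ gbar : ℝ} (hε : 0 < ε₀)
    {α : Fin m → Fin m → Fin m → ℤ × ℤ × ℤ → ℝ} {X₀ : Fin m → ℝ} {X : Fin m → ℤ → ℝ → ℝ}
    {g : Fin m → ℤ → ℝ → ℝ}
    (hcont : ∀ i n, ContDiffOn ℝ 1 (X i n) (Ici 0))
    (hapriori : ∀ T : ℝ, 0 < T → ∃ M : ℝ, ∀ t ∈ Icc 0 T, ∀ (i : Fin m) (n : ℤ),
      (1 + (1 + ε₀) ^ ((10 : ℝ) * n)) * |X i n t| ≤ M)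
    (hinit : ∀ i n, X i n 0 = if n = 0 then X₀ i else 0)
    (hmotion : ∀ i n t, 0 ≤ t →
      derivWithin (X i n) (Ici 0) t =
        quadTerm ε₀ α X i n t - g i n t * (1 + ε₀) ^ ((2 : ℝ) * n) * X i n t)
    (hg0 : ∀ i n t, 0 ≤ t → 0 ≤ g i n t) (hg1 : ∀ i n t, 0 ≤ t → g i n t ≤ gbar)
    (hnoLow : ∀ i n t, n < 0 → 0 ≤ t → X i n t = 0) :
    HasGlobal ε₀ α (gbar * Real.sqrt 2) 0 0 X₀ := by
  have hB : 0 < 1 + ε₀ := by linarith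
  have h2 : 0 < Real.sqrt 2 := Real.sqrt_pos.2 two_pos
  have h2' : 1 ≤ Real.sqrt 2 := by
    rw [show (1 : ℝ) = Real.sqrt 1 from Real.sqrt_one.symm]
    exact Real.sqrt_le_sqrt (by norm_num)
  refine ⟨X, fun i n t => 1 / 2 * X i n t ^ 2, ?_⟩
  exact
  { contDiffOn_X := hcont
    contDiffOn_E := fun i n => contDiffOn_const.mul ((hcont i n).pow 2)
    nonneg_E := fun i n t _ => by positivity
    apriori_X := hapriori
    apriori_E := by
      intro T hT
      obtain ⟨M, hM⟩ := hapriori T hT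
      refine ⟨M, fun t ht i n => ?_⟩
      have hw : 0 ≤ 1 + (1 + ε₀) ^ ((10 : ℝ) * n) :=
        add_nonneg zero_le_one (Real.rpow_nonneg hB.le _)
      calc (1 + (1 + ε₀) ^ ((10 : ℝ) * n)) * Real.sqrt (1 / 2 * X i n t ^ 2)
          = (1 + (1 + ε₀) ^ ((10 : ℝ) * n)) * (|X i n t| / Real.sqrt 2) := by rw [sqrt_half_sq]
        _ ≤ (1 + (1 + ε₀) ^ ((10 : ℝ) * n)) * |X i n t| :=
            mul_le_mul_of_nonneg_left (div_le_self (abs_nonneg _) h2') hw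
        _ ≤ M := hM t ht i n
    init_E := fun i n => rfl
    init_X := hinit
    motion := by
      intro i n t ht
      rw [hmotion i n t ht, sqrt_half_sq,
        show quadTerm ε₀ α X i n t - g i n t * (1 + ε₀) ^ ((2 : ℝ) * n) * X i n t
              - quadTerm ε₀ α X i n t
            = -(g i n t * (1 + ε₀) ^ ((2 : ℝ) * n) * X i n t) by ring,
        abs_neg, abs_mul, abs_mul, abs_of_nonneg (hg0 i n t ht),
        abs_of_nonneg (Real.rpow_nonneg hB.le _)]
      have hpow : 0 ≤ (1 + ε₀) ^ ((2 : ℝ) * n) := Real.rpow_nonneg hB.le _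
      have hX : 0 ≤ |X i n t| := abs_nonneg _
      calc g i n t * (1 + ε₀) ^ ((2 : ℝ) * n) * |X i n t|
          ≤ gbar * (1 + ε₀) ^ ((2 : ℝ) * n) * |X i n t| := by
            gcongr
            exact hg1 i n t ht
        _ = gbar * Real.sqrt 2 * (1 + ε₀) ^ ((2 : ℝ) * n) * (|X i n t| / Real.sqrt 2) := by
            field_simp
    energy := by
      intro i n t ht
      rw [derivWithin_half_sq_Ici (hcont i n) ht, hmotion i n t ht]
      have : 0 ≤ g i n t * (1 + ε₀) ^ ((2 : ℝ) * n) * X i n t ^ 2 :=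
        mul_nonneg (mul_nonneg (hg0 i n t ht) (Real.rpow_nonneg hB.le _)) (sq_nonneg _)
      nlinarith [this]
    defect_lower := fun i n t _ => le_rfl
    defect_upper := fun i n t _ => by simp
    noLow_X := hnoLow
    noLow_E := fun i n t hn ht => by simp [hnoLow i n t hn ht] }

/-- **Robust blow-up resists every small gain field.** If `NoGlobalCascade ε₀ α X₀` (`ε₀ > 0`), there is
`ḡ₀ > 0` such that for every gain field `g` with `0 ≤ g_{i,n}(t) ≤ ḡ₀` on `t ≥ 0` NO family `X` is `C¹` on
`[0,∞)`, (4.5)-regular on every `[0,T]`, issued from the one-shell datum at shell `0`, zero below shell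
`0`, and driven by `∂ₜX = quadTerm(X) − g(1+ε₀)^{2n}X` on `[0,∞)`: no absorber, viscosity ramp or switching
law inside the budget `ḡ₀` tames the cascade (κ-normal form `noGlobalCascade_iff_kappa` +
`hasGlobal_of_gainField` + `hasGlobal_mono`).
[cite: Tao2016AveragedNS, §4 Thm. 4.2 with Lemma 4.1 (4.5)–(4.11); cell vocabulary (`NoGlobalCascade`)] -/
theorem not_gainField_of_noGlobalCascade {ε₀ : ℝ} (hε : 0 < ε₀)
    {α : Fin m → Fin m → Fin m → ℤ × ℤ × ℤ → ℝ} {X₀ : Fin m → ℝ}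
    (hNG : NoGlobalCascade ε₀ α X₀) :
    ∃ gbar : ℝ, 0 < gbar ∧ ∀ (g : Fin m → ℤ → ℝ → ℝ) (X : Fin m → ℤ → ℝ → ℝ),
      (∀ i n t, 0 ≤ t → 0 ≤ g i n t) → (∀ i n t, 0 ≤ t → g i n t ≤ gbar) →
      (∀ i n, ContDiffOn ℝ 1 (X i n) (Ici 0)) →
      (∀ i n, X i n 0 = if n = 0 then X₀ i else 0) →
      (∀ i n t, n < 0 → 0 ≤ t → X i n t = 0) →
      (∀ i n t, 0 ≤ t → derivWithin (X i n) (Ici 0) t =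
        quadTerm ε₀ α X i n t - g i n t * (1 + ε₀) ^ ((2 : ℝ) * n) * X i n t) →
      ¬ ∀ T : ℝ, 0 < T → ∃ M : ℝ, ∀ t ∈ Icc 0 T, ∀ (i : Fin m) (n : ℤ),
          (1 + (1 + ε₀) ^ ((10 : ℝ) * n)) * |X i n t| ≤ M := by
  obtain ⟨κ, hκ, hno⟩ := (noGlobalCascade_iff_kappa hε).1 hNG
  have h2 : 0 < Real.sqrt 2 := Real.sqrt_pos.2 two_pos
  refine ⟨κ / Real.sqrt 2, div_pos hκ h2, ?_⟩
  intro g X hg0 hg1 hcont hinit hnoLow hmotion hapriori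
  have hG := hasGlobal_of_gainField hε hcont hapriori hinit hmotion hg0 hg1 hnoLow
  rw [div_mul_cancel₀ κ h2.ne'] at hG
  exact hno (hasGlobal_mono hε.le hG le_rfl hκ.le)

/-- **No "exact first, absorb later" flow inside the budget.** With `ḡ₀` as in
`not_gainField_of_noGlobalCascade`: for every switching time `t₁` and every gain field `g` with
`0 ≤ g ≤ ḡ₀` that VANISHES on `[0,t₁)` (the flow is exact until `t₁` and damped afterwards), no global
(4.5)-regular `C¹` flow from the datum obeys `∂ₜX = quadTerm(X) − g(1+ε₀)^{2n}X` — the shape of an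
absorber switched on after the front has thinned out, which therefore cannot exist for a robust blow-up.
[cite: Tao2016AveragedNS, §4 Thm. 4.2 with Lemma 4.1 (4.5)–(4.11); cell vocabulary (`NoGlobalCascade`)] -/
theorem not_gainField_of_noGlobalCascade_switched {ε₀ : ℝ} (hε : 0 < ε₀)
    {α : Fin m → Fin m → Fin m → ℤ × ℤ × ℤ → ℝ} {X₀ : Fin m → ℝ}
    (hNG : NoGlobalCascade ε₀ α X₀) :
    ∃ gbar : ℝ, 0 < gbar ∧ ∀ (t₁ : ℝ) (g : Fin m → ℤ → ℝ → ℝ) (X : Fin m → ℤ → ℝ → ℝ),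
      (∀ i n t, 0 ≤ t → t < t₁ → g i n t = 0) →
      (∀ i n t, t₁ ≤ t → 0 ≤ g i n t ∧ g i n t ≤ gbar) →
      (∀ i n, ContDiffOn ℝ 1 (X i n) (Ici 0)) →
      (∀ i n, X i n 0 = if n = 0 then X₀ i else 0) →
      (∀ i n t, n < 0 → 0 ≤ t → X i n t = 0) →
      (∀ i n t, 0 ≤ t → derivWithin (X i n) (Ici 0) t =
        quadTerm ε₀ α X i n t - g i n t * (1 + ε₀) ^ ((2 : ℝ) * n) * X i n t) →
      ¬ ∀ T : ℝ, 0 < T → ∃ M : ℝ, ∀ t ∈ Icc 0 T, ∀ (i : Fin m) (n : ℤ),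
          (1 + (1 + ε₀) ^ ((10 : ℝ) * n)) * |X i n t| ≤ M := by
  obtain ⟨gbar, hgbar, H⟩ := not_gainField_of_noGlobalCascade hε hNG
  refine ⟨gbar, hgbar, fun t₁ g X hoff hon hcont hinit hnoLow hmotion => ?_⟩
  refine H g X (fun i n t ht => ?_) (fun i n t ht => ?_) hcont hinit hnoLow hmotion
  · by_cases h : t < t₁
    · rw [hoff i n t ht h]
    · exact (hon i n t (not_lt.1 h)).1
  · by_cases h : t < t₁
    · rw [hoff i n t ht h]; exact hgbar.le
    · exact (hon i n t (not_lt.1 h)).2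

end BlowupRigidityOne

end Summit.NavierStokesRegularity.NavierStokesRegularity.Theorems

end
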